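import Summits.AtomisticToContinuum.BoseEinsteinCondensation.Theorems.BECGroundStateSOSPeriodicIRBoundFsumBootstrapAssembly
import Summits.AtomisticToContinuum.BoseEinsteinCondensation.Theorems.BECGroundStateSOSPeriodicIRBoundFsumMomentIneq
import Summits.AtomisticToContinuum.BoseEinsteinCondensation.Theorems.BECGroundStateSOSPeriodicIRBoundFsumExcitedPairs
import Summits.AtomisticToContinuum.BoseEinsteinCondensation.Theorems.BECGroundStateSOSPeriodicIRBoundFsumWindowSum
import Summits.AtomisticToContinuum.BoseEinsteinCondensation.Theorems.BECGroundStateSOSPeriodicIRBoundFsumDichotomy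
import Summits.AtomisticToContinuum.BoseEinsteinCondensation.Theorems.BECGroundStateSOSPeriodicIRBoundFsumPathTransport
import Summits.AtomisticToContinuum.BoseEinsteinCondensation.Theorems.BECGroundStateSOSPeriodicIRBoundFsumCouplingSelect
import HarnessLib

/-!
# Crux `PeriodicIRBound` (stmt-AtomisticToContinuum-3972), line `fsum-phase-pencil`, stub S5
# `stub_normalisationBootstrap` — CLOSED

The registered stub S5 of the skeleton `Cruxes/PeriodicIRBound/Lines/fsum_phase_pencil.lean`:

`NormalisationBootstrap` — for every potential class `𝒱(R₀, V₁)`: the no-cat input on the class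
(`CondensateNumberVarianceClass`: `Var_Ψ(n̂₀) ≤ C_V N` for near-minimisers) and the `n₀`-weighted infrared bound
on the class (`WeightedClassBound`: `‖U_kΨ‖² + ‖P_kΨ‖² ≤ C N√ρ L_N/‖k‖_∞` on every window) imply the crux's own
infrared bound `IRBoundFor w` for EVERY potential `w` of the class.

It is the composition of the landed helper files of seat c8 (wave 2), all at fixed `(N, L)` with `δ` chosen after `N`:

* the Fourier-diagonal occupation calculus (`FsumOccFourier`: `‖a_pΨ‖²`, `‖a_pa_qΨ‖²` as `∑_ν mult·|ĉ_ν|²`) and the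
  MOMENT INEQUALITY `N·n_k − ⟨n₀n_k⟩ ≤ (N/2)·n_k + N·Var(n₀)/(n̄₀ − N/2)` (`FsumMomentIneq`, a pointwise polynomial
  inequality summed against the Fourier weights — no spectral theorem);
* the excited-pair mass identity `∑_q ‖a_qa₀Ψ‖² = (N−1)‖a₀Ψ‖²` and its ultraviolet tail bound by the kinetic energy
  (`FsumExcitedPairs`), the weighted window sum `∑_window ‖T_{q0}Ψ‖² ≤ 13Cκ′²√ρN²` (`FsumWindowSum`, lattice shells
  `#{‖q‖_∞ = j} ≤ 26j²`), whence the DICHOTOMY `n̄₀ ≤ 0.15N ∨ n̄₀ ≥ 0.85N` for near-minimisers of every class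
  potential (`FsumDichotomy`, with the Hartree bound and no-cat);
* the continuity of the variational problem along the coupling path `t ↦ t·w` (`FsumPathTransport`) and the
  COUPLING SELECTION of the condensed branch at `t = 1` (`FsumCouplingSelect`: Ky Fan gap ⇒ clustering of
  near-minimisers — both in tree —, `L²`-Lipschitz continuity of `n₀` modulo phase, free anchor `N ≤ n₀ + L²E/4π²`,
  connectedness of `[0,1]`);
* the assembly `n_k ≤ (2/N)⟨n₀n_k⟩ + 6C_V ≤ (C + 6C_Vκ)√ρL_N/‖k‖_∞` (`FsumBootstrapAssembly`).
-/

noncomputable section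

namespace Summit.AtomisticToContinuum.BoseEinsteinCondensation.Cruxes.PeriodicIRBound.FsumPhasePencil

/-- **S5 `stub_normalisationBootstrap` (registered stub of the line `fsum-phase-pencil`, CLOSED):** the
normalisation bootstrap `NormalisationBootstrap` — the assembly `stub_fsumBootstrapAssembly` fed with the moment
inequality `stub_fsumMomentIneq`, the dichotomy `stub_fsumDichotomy` (itself fed with the excited-pair identities
`stub_fsumExcitedPairs` and the window sum `stub_fsumWindowSum`) and the coupling selection `stub_fsumCouplingSelect`
(fed with the path transport `stub_fsumPathTransport`). [folklore] -/
theorem stub_normalisationBootstrap :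
    Summit.AtomisticToContinuum.BoseEinsteinCondensation.Cruxes.PeriodicIRBound.FsumPhasePencil.NormalisationBootstrap :=
  stub_fsumBootstrapAssembly stub_fsumMomentIneq
    (stub_fsumDichotomy stub_fsumExcitedPairs.1 stub_fsumExcitedPairs.2 stub_fsumWindowSum)
    (stub_fsumCouplingSelect stub_fsumPathTransport)

end Summit.AtomisticToContinuum.BoseEinsteinCondensation.Cruxes.PeriodicIRBound.FsumPhasePencil

end
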